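import Mathlib.MeasureTheory.Measure.Lebesgue.VolumeOfBalls
import Mathlib.MeasureTheory.Group.GeometryOfNumbers
import Mathlib.Analysis.Seminorm
import Mathlib.LinearAlgebra.Matrix.ToLin
import Mathlib.LinearAlgebra.Determinant
import Mathlib.LinearAlgebra.FreeModule.Finite.CardQuotient
import HarnessLib

/-!
# Geometry of numbers behind Evertse–Győry, Proposition 4.3.4 (proved lemmas)

Topic `NumberTheory/DiophantineGeometry`; namespace
`Literature.NumberTheory.DiophantineGeometry.Dioph`.
Companion of `MultiplicativeGroupApproximation.lean` (the named fact
`evertseGyory_thm_4_2_1_rat`, Evertse–Győry Thm 4.2.1 for `K = ℚ`) and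
`MultiplicativeGroupApproximationProofs.lean` (its proved elementary ingredients).

Evertse–Győry, *Unit Equations in Diophantine Number Theory* (2015), §4.3.1 "Some geometry of
numbers" (book pp. 69–73) proves Proposition 4.3.4 — the geometry-of-numbers input of the proof
of Theorem 4.2.1 — from Minkowski's second theorem (Thm 4.3.1), Mahler's basis theorem
(Thm 4.3.3), the Borosh–Flahive–Rubin–Treybig lemma (Lemma 4.3.5) and two further lemmas
(4.3.6, 4.3.7). This file PROVES these ingredients for a norm `N` on `ℝ^q = Fin q → ℝ`
(rendered as a `Seminorm ℝ (Fin q → ℝ)`, definite where needed) and the lattice `ℤ^q`, which is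
the setting the book reduces to on p. 71 ("We assume that `V = ℝ^q`, `L = ℤ^q` which is no loss of
generality"). Everything here is a theorem; no named facts are introduced.

Contents of this first instalment:

* `seminorm_le_sum_mul_norm`, `seminorm_continuous`, `exists_pos_mul_norm_le_seminorm`,
  `volume_seminormBall_lt_top`: a (definite) seminorm on `ℝ^q` is continuous and comparable with
  the sup norm, so its unit ball `B_N = {x | N x ≤ 1}` has finite volume `V` [folklore];
* `volume_sum_abs_le_one`: the cross-polytope `{∑ |cᵢ| ≤ 1}` has volume `2^q / q!`
  (Mathlib's `MeasureTheory.volume_sum_rpow_le` at `p = 1`) [folklore];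
* `abs_det_le_of_seminorm` (**Evertse–Győry, Lemma 4.3.6**, p. 72): for `f₁, …, f_q ∈ ℝ^q`,
  `|det(f₁, …, f_q)| ≤ (q!/2^q) · V · N(f₁) ⋯ N(f_q)`, because the convex hull of the
  `± fᵢ / N(fᵢ)` lies in `B_N` and has volume `(2^q/q!) |det(fᵢ / N(fᵢ))|`;
* `bfrt_exists_small_solution` (**Borosh–Flahive–Rubin–Treybig 1989 = Evertse–Győry,
  Lemma 4.3.5**, p. 72): if `f₁, …, f_n ∈ ℤ^m` generate `ℤ^m` and `f₀ ∈ ℤ^m`, then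
  `f₀ = ∑ bᵢ fᵢ` with integers `|bᵢ| ≤ M`, `M` the maximal absolute value of the `m × m` minors
  of `(f₀, f₁, …, f_n)` (stated in bounded form: any `R ≥` all these minors bounds the `|bᵢ|`).
  The proof given here: a maximal minor `A`, Cramer's rule (`Matrix.cramer`), the index
  `[ℤ^m : A ℤ^m] = |det A|` (`Submodule.natAbs_det_basis_change`) and a word-length bound in a
  finite set of sums (`exists_sum_nsmul_eq_of_sum_le`); `exists_minor_ne_zero` supplies a
  non-zero minor.

## References

* [EvertseGyory2015] J.-H. Evertse, K. Győry, *Unit Equations in Diophantine Number Theory*,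
  Cambridge Stud. Adv. Math. 146, CUP 2015, doi:10.1017/CBO9781316160749 — §4.3.1, Lemmas 4.3.5
  and 4.3.6 (p. 72).
* [BoroshFlahiveRubinTreybig1989] I. Borosh, M. Flahive, D. Rubin, B. Treybig, *A sharp bound for
  solutions of linear Diophantine equations*, Proc. Amer. Math. Soc. 105 (1989), 844–846.
-/

noncomputable section

open MeasureTheory Real Finset Module Set
open scoped Matrix

namespace Literature.NumberTheory.DiophantineGeometry.Dioph

variable {q : ℕ}

/-! ### Seminorms on `ℝ^q`: comparison with the sup norm; the unit ball has finite volume -/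

/-- For a seminorm `N` on `ℝ^q` and the standard basis vectors `eᵢ`:
`N x ≤ (∑ᵢ N eᵢ) · ‖x‖_∞`. [folklore] -/
theorem seminorm_le_sum_mul_norm (N : Seminorm ℝ (Fin q → ℝ)) (x : Fin q → ℝ) :
    N x ≤ (∑ i, N (Pi.single i 1)) * ‖x‖ := by
  have hx : x = ∑ i, x i • (Pi.single i (1 : ℝ) : Fin q → ℝ) := by
    ext j
    simp [Finset.sum_apply, Pi.single_apply]
  calc N x = N (∑ i, x i • (Pi.single i (1 : ℝ) : Fin q → ℝ)) := by rw [← hx]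
    _ ≤ ∑ i, N (x i • (Pi.single i (1 : ℝ) : Fin q → ℝ)) :=
        Finset.le_sum_of_subadditive N (map_zero N).le (fun a b => map_add_le_add N a b) _ _
    _ = ∑ i, |x i| * N (Pi.single i 1) := by
        refine Finset.sum_congr rfl fun i _ => ?_
        rw [map_smul_eq_mul, Real.norm_eq_abs]
    _ ≤ ∑ i, ‖x‖ * N (Pi.single i 1) := by
        refine Finset.sum_le_sum fun i _ => mul_le_mul_of_nonneg_right ?_ (apply_nonneg _ _)
        rw [← Real.norm_eq_abs]
        exact norm_le_pi_norm x i
    _ = (∑ i, N (Pi.single i 1)) * ‖x‖ := by rw [Finset.sum_mul]; simp [mul_comm]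

/-- A seminorm on `ℝ^q` is continuous (for the usual topology). [folklore] -/
theorem seminorm_continuous (N : Seminorm ℝ (Fin q → ℝ)) : Continuous N := by
  set C : ℝ := ∑ i, N (Pi.single i 1) with hC
  have hC0 : 0 ≤ C := Finset.sum_nonneg fun i _ => apply_nonneg _ _
  let c : NNReal := ⟨C, hC0⟩
  have hc : ∀ x, (c • normSeminorm ℝ (Fin q → ℝ)) x = C * ‖x‖ := fun x => by
    change c • ‖x‖ = C * ‖x‖
    rw [NNReal.smul_def, smul_eq_mul]
    rfl
  refine Seminorm.continuous_of_le (q := c • normSeminorm ℝ (Fin q → ℝ)) ?_ ?_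
  · have : ((c • normSeminorm ℝ (Fin q → ℝ) : Seminorm ℝ (Fin q → ℝ)) : (Fin q → ℝ) → ℝ) =
        fun x => C * ‖x‖ := funext hc
    rw [this]
    exact continuous_const.mul continuous_norm
  · intro x
    rw [hc]
    exact seminorm_le_sum_mul_norm N x

/-- A *definite* seminorm (i.e. a norm) on `ℝ^q` dominates a positive multiple of the sup norm:
`c ‖x‖_∞ ≤ N x` for some `c > 0` (minimum of `N` on the compact sup-norm unit sphere). [folklore] -/
theorem exists_pos_mul_norm_le_seminorm (N : Seminorm ℝ (Fin q → ℝ))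
    (hN : ∀ x, N x = 0 → x = 0) : ∃ c : ℝ, 0 < c ∧ ∀ x, c * ‖x‖ ≤ N x := by
  rcases isEmpty_or_nonempty (Fin q) with hq | hq
  · refine ⟨1, one_pos, fun x => ?_⟩
    have : x = 0 := Subsingleton.elim x 0
    simp [this]
  · obtain ⟨i⟩ := hq
    have hne : (Metric.sphere (0 : Fin q → ℝ) 1).Nonempty := by
      refine ⟨Pi.single i 1, ?_⟩
      simp [Pi.norm_single]
    obtain ⟨x₀, hx₀, hmin⟩ := (isCompact_sphere (0 : Fin q → ℝ) 1).exists_isMinOn hne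
      (seminorm_continuous N).continuousOn
    have hx₀1 : ‖x₀‖ = 1 := by simpa [Metric.mem_sphere, dist_zero_right] using hx₀
    have hx₀0 : x₀ ≠ 0 := by
      intro h; rw [h, norm_zero] at hx₀1; exact zero_ne_one hx₀1
    have hpos : 0 < N x₀ := by
      rcases (apply_nonneg N x₀).lt_or_eq with h | h
      · exact h
      · exact absurd (hN x₀ h.symm) hx₀0
    refine ⟨N x₀, hpos, fun x => ?_⟩
    by_cases hx : x = 0
    · simp [hx]
    · have hnx : 0 < ‖x‖ := norm_pos_iff.mpr hx
      have hmem : ‖x‖⁻¹ • x ∈ Metric.sphere (0 : Fin q → ℝ) 1 := by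
        simp [norm_smul, inv_mul_cancel₀ hnx.ne']
      have h := hmin hmem
      simp only [Set.mem_setOf_eq] at h
      rw [map_smul_eq_mul, Real.norm_eq_abs, abs_inv, abs_of_pos hnx] at h
      -- `h : N x₀ ≤ ‖x‖⁻¹ * N x`
      have := mul_le_mul_of_nonneg_left h hnx.le
      rwa [← mul_assoc, mul_inv_cancel₀ hnx.ne', one_mul, mul_comm] at this

/-- The unit ball `{x | N x ≤ 1}` of a definite seminorm on `ℝ^q` is bounded, hence has finite
Lebesgue measure. [folklore] -/
theorem volume_seminormBall_lt_top (N : Seminorm ℝ (Fin q → ℝ)) (hN : ∀ x, N x = 0 → x = 0) :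
    volume {x : Fin q → ℝ | N x ≤ 1} < ⊤ := by
  obtain ⟨c, hc, hcN⟩ := exists_pos_mul_norm_le_seminorm N hN
  have hsub : {x : Fin q → ℝ | N x ≤ 1} ⊆ Metric.closedBall (0 : Fin q → ℝ) c⁻¹ := by
    intro x hx
    simp only [Set.mem_setOf_eq] at hx
    rw [Metric.mem_closedBall, dist_zero_right]
    have h1 : c * ‖x‖ ≤ 1 := (hcN x).trans hx
    calc ‖x‖ = c⁻¹ * (c * ‖x‖) := by field_simp
      _ ≤ c⁻¹ * 1 := mul_le_mul_of_nonneg_left h1 (inv_nonneg.mpr hc.le)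
      _ = c⁻¹ := mul_one _
  exact (measure_mono hsub).trans_lt (Metric.isBounded_closedBall.measure_lt_top)

/-- The unit ball `{x | N x ≤ 1}` of a seminorm on `ℝ^q` is closed, hence measurable. [folklore] -/
theorem measurableSet_seminormBall (N : Seminorm ℝ (Fin q → ℝ)) :
    MeasurableSet {x : Fin q → ℝ | N x ≤ 1} :=
  (isClosed_le (seminorm_continuous N) continuous_const).measurableSet

/-! ### The cross-polytope -/

/-- The cross-polytope `{c ∈ ℝ^q | ∑ |cᵢ| ≤ 1}` (`q ≥ 1`) has volume `2^q / q!`: the case `p = 1`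
of the volume of the unit ball of the `ℓ^p`-norm (Mathlib, `MeasureTheory.volume_sum_rpow_le`).
[folklore] -/
theorem volume_sum_abs_le_one (hq : 0 < q) :
    volume {c : Fin q → ℝ | ∑ i, |c i| ≤ 1} = ENNReal.ofReal (2 ^ q / q.factorial) := by
  haveI : Nonempty (Fin q) := ⟨⟨0, hq⟩⟩
  have h := MeasureTheory.volume_sum_rpow_le (Fin q) (p := 1) le_rfl 1
  have hset : {x : Fin q → ℝ | (∑ i, |x i| ^ (1 : ℝ)) ^ (1 / (1 : ℝ)) ≤ 1} =
      {c : Fin q → ℝ | ∑ i, |c i| ≤ 1} := by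
    ext x
    simp only [Set.mem_setOf_eq, Real.rpow_one, div_one]
  rw [hset] at h
  rw [h]
  have h2 : Real.Gamma 2 = 1 := by
    rw [show (2 : ℝ) = (1 : ℕ) + 1 by norm_num, Real.Gamma_nat_eq_factorial, Nat.factorial_one,
      Nat.cast_one]
  simp only [Fintype.card_fin, ENNReal.ofReal_one, one_pow, one_mul, div_one, one_add_one_eq_two,
    h2, mul_one, Real.Gamma_nat_eq_factorial]

/-! ### Evertse–Győry, Lemma 4.3.6 -/

/-- **Evertse–Győry, Lemma 4.3.6** (p. 72), core case. Let `N` be a norm on `ℝ^q` (`q ≥ 1`) with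
unit ball `B_N = {x | N x ≤ 1}` of (finite) volume `V`, and let `f₁, …, f_q ∈ ℝ^q` with
`N(fᵢ) ≠ 0`. Then `|det(f₁, …, f_q)| ≤ (q!/2^q) · V · N(f₁) ⋯ N(f_q)`. Proof as printed: with
`gᵢ := fᵢ / N(fᵢ)`, the convex hull `D` of the `±gᵢ` — the image of the cross-polytope under
`c ↦ ∑ cᵢ gᵢ` — lies in `B_N`, and `vol(D) = (2^q/q!) |det(g₁, …, g_q)|`. (The matrix
`Matrix.of f` has the `fᵢ` as rows; the determinant is the same as with columns.)
[cite: EvertseGyory2015, Lemma 4.3.6 (p. 72)] -/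
theorem abs_det_le_of_seminorm_of_ne_zero (hq : 0 < q) (N : Seminorm ℝ (Fin q → ℝ))
    (hV : volume {x : Fin q → ℝ | N x ≤ 1} ≠ ⊤) (f : Fin q → Fin q → ℝ)
    (hf : ∀ i, N (f i) ≠ 0) :
    |(Matrix.of f).det| ≤
      (q.factorial / 2 ^ q) * (volume {x : Fin q → ℝ | N x ≤ 1}).toReal * ∏ i, N (f i) := by
  -- the normalised vectors `g i` and the linear map `c ↦ ∑ c_i • g i`
  set g : Fin q → Fin q → ℝ := fun i => (N (f i))⁻¹ • f i with hg
  have hNg : ∀ i, N (g i) = 1 := by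
    intro i
    rw [hg]
    simp only
    rw [map_smul_eq_mul, Real.norm_eq_abs, abs_inv, abs_of_nonneg (apply_nonneg _ _),
      inv_mul_cancel₀ (hf i)]
  set G : Matrix (Fin q) (Fin q) ℝ := Matrix.of fun i j => g j i with hG
  set T : (Fin q → ℝ) →ₗ[ℝ] (Fin q → ℝ) := Matrix.toLin' G with hT
  have hTapply : ∀ c : Fin q → ℝ, T c = ∑ j, c j • g j := by
    intro c
    ext i
    rw [hT, Matrix.toLin'_apply]
    simp [Matrix.mulVec, dotProduct, hG, Finset.sum_apply, mul_comm]
  -- the image of the cross-polytope lies in the unit ball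
  set C : Set (Fin q → ℝ) := {c | ∑ i, |c i| ≤ 1} with hCdef
  set B : Set (Fin q → ℝ) := {x | N x ≤ 1} with hBdef
  have himage : T '' C ⊆ B := by
    rintro _ ⟨c, hc, rfl⟩
    simp only [hBdef, hCdef, Set.mem_setOf_eq] at hc ⊢
    rw [hTapply]
    calc N (∑ j, c j • g j) ≤ ∑ j, N (c j • g j) :=
          Finset.le_sum_of_subadditive N (map_zero N).le (fun a b => map_add_le_add N a b) _ _
      _ = ∑ j, |c j| := by
          refine Finset.sum_congr rfl fun j _ => ?_
          rw [map_smul_eq_mul, Real.norm_eq_abs, hNg j, mul_one]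
      _ ≤ 1 := hc
  -- volumes
  have hvolC : volume C = ENNReal.ofReal (2 ^ q / q.factorial) := volume_sum_abs_le_one hq
  have hvolTC : volume (T '' C) = ENNReal.ofReal |LinearMap.det T| * volume C :=
    MeasureTheory.Measure.addHaar_image_linearMap volume T C
  have hdetT : LinearMap.det T = (∏ i, (N (f i))⁻¹) * (Matrix.of f).det := by
    rw [hT, LinearMap.det_toLin']
    have hGt : G = (Matrix.of fun i j => (N (f i))⁻¹ * (Matrix.of f) i j).transpose := by
      ext i j
      simp [hG, hg, Matrix.transpose_apply]
    rw [hGt, Matrix.det_transpose, Matrix.det_mul_column]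
  have hle : ENNReal.ofReal |LinearMap.det T| * volume C ≤ volume B := by
    rw [← hvolTC]; exact measure_mono himage
  rw [hvolC, ← ENNReal.ofReal_mul (abs_nonneg _)] at hle
  have hle' : |LinearMap.det T| * (2 ^ q / q.factorial) ≤ (volume B).toReal := by
    rw [← ENNReal.ofReal_le_iff_le_toReal hV]
    exact hle
  rw [hdetT, abs_mul, abs_of_nonneg (Finset.prod_nonneg fun i _ => inv_nonneg.mpr
    (apply_nonneg _ _))] at hle'
  -- rearrange
  have hprod : 0 < ∏ i, N (f i) :=
    Finset.prod_pos fun i _ => (apply_nonneg N (f i)).lt_of_ne (hf i).symm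
  have hprodinv : (∏ i, (N (f i))⁻¹) = (∏ i, N (f i))⁻¹ := by
    rw [Finset.prod_inv_distrib]
  rw [hprodinv] at hle'
  have hfac : (0 : ℝ) < 2 ^ q / q.factorial := by positivity
  -- `hle' : (∏ N fᵢ)⁻¹ * |det| * (2^q/q!) ≤ V`
  have key : |(Matrix.of f).det| * (2 ^ q / q.factorial) ≤
      (volume B).toReal * ∏ i, N (f i) := by
    have := mul_le_mul_of_nonneg_right hle' hprod.le
    calc |(Matrix.of f).det| * (2 ^ q / q.factorial)
        = (∏ i, N (f i))⁻¹ * |(Matrix.of f).det| * (2 ^ q / ↑q.factorial) * ∏ i, N (f i) := by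
          field_simp
      _ ≤ (volume B).toReal * ∏ i, N (f i) := this
  calc |(Matrix.of f).det|
      = |(Matrix.of f).det| * (2 ^ q / q.factorial) * (q.factorial / 2 ^ q) := by
        field_simp
    _ ≤ (volume B).toReal * (∏ i, N (f i)) * (q.factorial / 2 ^ q) :=
        mul_le_mul_of_nonneg_right key (by positivity)
    _ = (q.factorial / 2 ^ q) * (volume B).toReal * ∏ i, N (f i) := by ring

/-- **Evertse–Győry, Lemma 4.3.6** (p. 72). Let `N` be a norm (a definite seminorm) on `ℝ^q`
(`q ≥ 1`), `V` the volume of its unit ball `{x | N x ≤ 1}`, and `f₁, …, f_q ∈ ℝ^q`. Then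
`|det(f₁, …, f_q)| ≤ (q!/2^q) · V · N(f₁) ⋯ N(f_q)`. (If some `fᵢ = 0` both sides vanish;
otherwise this is `abs_det_le_of_seminorm_of_ne_zero`.)
[cite: EvertseGyory2015, Lemma 4.3.6 (p. 72)] -/
theorem abs_det_le_of_seminorm (hq : 0 < q) (N : Seminorm ℝ (Fin q → ℝ))
    (hN : ∀ x, N x = 0 → x = 0) (f : Fin q → Fin q → ℝ) :
    |(Matrix.of f).det| ≤
      (q.factorial / 2 ^ q) * (volume {x : Fin q → ℝ | N x ≤ 1}).toReal * ∏ i, N (f i) := by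
  by_cases hf : ∀ i, N (f i) ≠ 0
  · exact abs_det_le_of_seminorm_of_ne_zero hq N (volume_seminormBall_lt_top N hN).ne f hf
  · push Not at hf
    obtain ⟨i, hi⟩ := hf
    have hfi : f i = 0 := hN _ hi
    have hdet : (Matrix.of f).det = 0 := by
      refine Matrix.det_eq_zero_of_row_eq_zero i fun j => ?_
      simp [hfi]
    rw [hdet, abs_zero]
    exact mul_nonneg (mul_nonneg (by positivity) ENNReal.toReal_nonneg)
      (Finset.prod_nonneg fun j _ => apply_nonneg _ _)

/-! ### The Borosh–Flahive–Rubin–Treybig bound (Evertse–Győry, Lemma 4.3.5): preparations -/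

section BFRT

/-- If integer vectors `f_j` (`j ∈ κ`) generate `ℤ^m` as a `ℤ`-module, some `m` of them have a
non-zero determinant. [folklore] -/
theorem exists_minor_ne_zero {m : ℕ} {κ : Type*} [Fintype κ] (f : κ → Fin m → ℤ)
    (hgen : Submodule.span ℤ (Set.range f) = ⊤) :
    ∃ e : Fin m → κ, Function.Injective e ∧ (Matrix.of fun i k => f (e k) i).det ≠ 0 := by
  classical
  -- the rational family spans `ℚ^m`
  let g : κ → Fin m → ℚ := fun j i => (f j i : ℚ)
  have hsingle : ∀ i₀, (Pi.single i₀ (1 : ℚ) : Fin m → ℚ) ∈ Submodule.span ℚ (Set.range g) := by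
    intro i₀
    have hi : (Pi.single i₀ (1 : ℤ) : Fin m → ℤ) ∈ Submodule.span ℤ (Set.range f) := by
      rw [hgen]; exact Submodule.mem_top
    obtain ⟨c, hc⟩ := (Submodule.mem_span_range_iff_exists_fun ℤ).mp hi
    have heq : (Pi.single i₀ (1 : ℚ) : Fin m → ℚ) = ∑ j, (c j : ℚ) • g j := by
      ext i'
      have := congrArg (fun v : Fin m → ℤ => (v i' : ℚ)) hc
      simp only [Finset.sum_apply, Pi.smul_apply, smul_eq_mul, Int.cast_sum, Int.cast_mul] at this
      rw [Finset.sum_apply]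
      simp only [Pi.smul_apply, smul_eq_mul, g]
      rw [this]
      simp [Pi.single_apply]
    rw [heq]
    exact Submodule.sum_mem _ fun j _ => Submodule.smul_mem _ _ (Submodule.subset_span ⟨j, rfl⟩)
  have hg : Submodule.span ℚ (Set.range g) = ⊤ := by
    refine Submodule.eq_top_iff'.mpr fun x => ?_
    have hx : x = ∑ i, x i • (Pi.single i (1 : ℚ) : Fin m → ℚ) := by
      ext j
      simp [Finset.sum_apply, Pi.single_apply]
    rw [hx]
    exact Submodule.sum_mem _ fun i _ => Submodule.smul_mem _ _ (hsingle i)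
  -- extract a basis among the `g j`
  obtain ⟨κ', a, ha, hspan, hli⟩ := exists_linearIndependent' (K := ℚ) g
  haveI : Finite κ' := Finite.of_injective a ha
  letI : Fintype κ' := Fintype.ofFinite κ'
  have hcard : Fintype.card κ' = m := by
    have h1 := linearIndependent_iff_card_eq_finrank_span.mp hli
    rw [h1, Set.finrank, hspan, hg, finrank_top, Module.finrank_fin_fun]
  let σ : κ' ≃ Fin m := Fintype.equivFinOfCardEq hcard
  refine ⟨a ∘ σ.symm, ha.comp σ.symm.injective, ?_⟩
  have hli' : LinearIndependent ℚ (g ∘ (a ∘ σ.symm)) := by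
    have := hli.comp σ.symm σ.symm.injective
    simpa [Function.comp_assoc] using this
  set A : Matrix (Fin m) (Fin m) ℤ := Matrix.of fun i k => f (a (σ.symm k)) i with hA
  set AQ : Matrix (Fin m) (Fin m) ℚ := Matrix.of fun i k => g (a (σ.symm k)) i with hAQ
  have hmap : (Int.castRingHom ℚ).mapMatrix A = AQ := by
    ext i k
    simp [hA, hAQ, g]
  have hcol : AQ.col = g ∘ (a ∘ σ.symm) := by
    ext k i
    simp [Matrix.col, hAQ]
  have hunit : IsUnit AQ := Matrix.linearIndependent_cols_iff_isUnit.mp (hcol ▸ hli')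
  have hdetQ : AQ.det ≠ 0 := ((Matrix.isUnit_iff_isUnit_det _).mp hunit).ne_zero
  intro hdet
  have hdet' : A.det = 0 := hdet
  apply hdetQ
  rw [← hmap, ← RingHom.map_det, hdet', map_zero]

/-- A word-length bound in a finite set of sums. Let `g : ν → G` be finitely many elements of an
additive commutative monoid and suppose all `ℕ`-combinations `∑ t_j • g_j` lie in a finite set `T`.
Then every such combination can be rewritten as `∑ t_j • g_j` with `∑ t_j ≤ #T − 1`. (The sets
`R_s` of combinations of total weight `≤ s` strictly grow with `s` until they exhaust all
combinations.) [folklore] -/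
theorem exists_sum_nsmul_eq_of_sum_le {G : Type*} [AddCommMonoid G] [DecidableEq G] {ν : Type*}
    [Fintype ν] (g : ν → G) (T : Finset G) (hT : ∀ t : ν → ℕ, ∑ j, t j • g j ∈ T) (t₀ : ν → ℕ) :
    ∃ t : ν → ℕ, ∑ j, t j • g j = ∑ j, t₀ j • g j ∧ ∑ j, t j + 1 ≤ T.card := by
  classical
  -- `R s` = combinations of total weight `≤ s`
  let R : ℕ → Finset G := fun s =>
    ((Fintype.piFinset fun _ : ν => Finset.range (s + 1)).filter (fun t => ∑ j, t j ≤ s)).image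
      (fun t => ∑ j, t j • g j)
  have memR : ∀ s x, x ∈ R s ↔ ∃ t : ν → ℕ, ∑ j, t j ≤ s ∧ ∑ j, t j • g j = x := by
    intro s x
    simp only [R, Finset.mem_image, Finset.mem_filter, Fintype.mem_piFinset, Finset.mem_range]
    constructor
    · rintro ⟨t, ⟨-, ht⟩, rfl⟩
      exact ⟨t, ht, rfl⟩
    · rintro ⟨t, ht, rfl⟩
      refine ⟨t, ⟨fun j => Nat.lt_succ_of_le ?_, ht⟩, rfl⟩
      exact (Finset.single_le_sum (fun i _ => Nat.zero_le (t i)) (Finset.mem_univ j)).trans ht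
  have R_mono : ∀ s, R s ⊆ R (s + 1) := by
    intro s x hx
    obtain ⟨t, ht, rfl⟩ := (memR s x).mp hx
    exact (memR _ _).mpr ⟨t, ht.trans (Nat.le_succ s), rfl⟩
  have R_sub_T : ∀ s, R s ⊆ T := by
    intro s x hx
    obtain ⟨t, -, rfl⟩ := (memR s x).mp hx
    exact hT t
  -- if `R s` is stable under adding the generators, it contains every combination
  have stable : ∀ s, (∀ x ∈ R s, ∀ j, x + g j ∈ R s) → ∀ t : ν → ℕ, ∑ j, t j • g j ∈ R s := by
    intro s hs
    suffices h : ∀ n, ∀ t : ν → ℕ, ∑ j, t j = n → ∑ j, t j • g j ∈ R s from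
      fun t => h _ t rfl
    intro n
    induction n with
    | zero =>
      intro t ht
      exact (memR s _).mpr ⟨t, by omega, rfl⟩
    | succ n ih =>
      intro t ht
      -- some `t j₀` is positive
      have hex : ∃ j₀, 0 < t j₀ := by
        by_contra h
        push Not at h
        have : ∑ j, t j = 0 := Finset.sum_eq_zero fun j _ => Nat.le_zero.mp (h j)
        omega
      obtain ⟨j₀, hj₀⟩ := hex
      let t' : ν → ℕ := Function.update t j₀ (t j₀ - 1)
      have hsum' : ∑ j, t' j = n := by
        have h1 : ∑ j, t' j + 1 = ∑ j, t j := by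
          have := Finset.sum_update_of_mem (Finset.mem_univ j₀) t (t j₀ - 1)
          -- `∑ update = (t j₀ - 1) + ∑ j ∈ univ \ {j₀}, t j`
          rw [this]
          have h2 := Finset.add_sum_erase Finset.univ t (Finset.mem_univ j₀)
          rw [Finset.sdiff_singleton_eq_erase]
          omega
        omega
      have hcomb : ∑ j, t j • g j = ∑ j, t' j • g j + g j₀ := by
        have e1 := Finset.add_sum_erase Finset.univ (fun j => t j • g j) (Finset.mem_univ j₀)
        have e2 := Finset.add_sum_erase Finset.univ (fun j => t' j • g j) (Finset.mem_univ j₀)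
        have e3 : ∑ j ∈ Finset.univ.erase j₀, t' j • g j = ∑ j ∈ Finset.univ.erase j₀, t j • g j := by
          refine Finset.sum_congr rfl fun j hj => ?_
          dsimp only [t']
          rw [Function.update_of_ne (Finset.ne_of_mem_erase hj)]
        rw [← e1, ← e2, e3]
        simp only [t', Function.update_self]
        have : t j₀ = (t j₀ - 1) + 1 := by omega
        conv_lhs => rw [this, add_nsmul, one_nsmul]
        abel
      rw [hcomb]
      exact hs _ (ih t' hsum') j₀
  -- growth
  have growth : ∀ s, s + 1 ≤ (R s).card ∨ ∀ t : ν → ℕ, ∑ j, t j • g j ∈ R s := by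
    intro s
    induction s with
    | zero =>
      left
      rw [Nat.zero_add, Nat.one_le_iff_ne_zero, ← Nat.pos_iff_ne_zero, Finset.card_pos]
      exact ⟨0, (memR 0 0).mpr ⟨0, by simp, by simp⟩⟩
    | succ s ih =>
      rcases ih with h | h
      · by_cases hst : ∀ x ∈ R s, ∀ j, x + g j ∈ R s
        · exact Or.inr fun t => R_mono s (stable s hst t)
        · left
          push Not at hst
          obtain ⟨x, hx, j, hxj⟩ := hst
          have hmem : x + g j ∈ R (s + 1) := by
            obtain ⟨t, ht, rfl⟩ := (memR s x).mp hx
            refine (memR _ _).mpr ⟨Function.update t j (t j + 1), ?_, ?_⟩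
            · rw [Finset.sum_update_of_mem (Finset.mem_univ j), Finset.sdiff_singleton_eq_erase]
              have := Finset.add_sum_erase Finset.univ t (Finset.mem_univ j)
              omega
            · have e1 := Finset.add_sum_erase Finset.univ (fun i => t i • g i) (Finset.mem_univ j)
              have e2 := Finset.add_sum_erase Finset.univ
                (fun i => Function.update t j (t j + 1) i • g i) (Finset.mem_univ j)
              have e3 : ∑ i ∈ Finset.univ.erase j, Function.update t j (t j + 1) i • g i =
                  ∑ i ∈ Finset.univ.erase j, t i • g i := by
                refine Finset.sum_congr rfl fun i hi => ?_
                rw [Function.update_of_ne (Finset.ne_of_mem_erase hi)]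
              rw [← e1, ← e2, e3]
              simp only [Function.update_self, add_nsmul, one_nsmul]
              abel
          have hss : R s ⊂ R (s + 1) := Finset.ssubset_iff_subset_ne.mpr
            ⟨R_mono s, fun heq => hxj (heq ▸ hmem)⟩
          have := Finset.card_lt_card hss
          omega
      · exact Or.inr fun t => R_mono s (h t)
  -- conclusion
  have hTpos : 0 < T.card := Finset.card_pos.mpr ⟨_, hT t₀⟩
  obtain ⟨s, hs⟩ : ∃ s, s + 1 = T.card := ⟨T.card - 1, by omega⟩
  have htarget : ∑ j, t₀ j • g j ∈ R s := by
    rcases growth s with h | h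
    · have hRT : R s = T := Finset.eq_of_subset_of_card_le (R_sub_T s) (by omega)
      rw [hRT]; exact hT t₀
    · exact h t₀
  obtain ⟨t, ht, heq⟩ := (memR s _).mp htarget
  exact ⟨t, heq, by omega⟩

/-- **Borosh–Flahive–Rubin–Treybig (1989) = Evertse–Győry, Lemma 4.3.5** (p. 72), in bounded
form. Let `f_j ∈ ℤ^m` (`j ∈ κ`) generate `ℤ^m` as a `ℤ`-module and let `f₀ ∈ ℤ^m`. If every `m × m`
minor of the augmented system `(f₀, (f_j)_j)` is at most `R` in absolute value, then
`f₀ = ∑ b_j f_j` for some integers `b_j` with `|b_j| ≤ R`. (The book's `M(f₀, …, f_m)` is the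
maximum of these minors; minors are indexed here by injective maps `Fin m → Option κ`, `none`
selecting the column `f₀`.) Proof: choose `m` columns `A = (f_{e(k)})_k` with `D = |det A|`
maximal (`D ≥ 1` by `exists_minor_ne_zero`); by Cramer's rule `A⁻¹ f_j` has entries of absolute
value `≤ 1` and `A⁻¹ f₀` entries `≤ R/D`; the admissible values of the remaining coefficients form
a coset of a subgroup of index `≤ D = [ℤ^m : A ℤ^m]`, which by `exists_sum_nsmul_eq_of_sum_le` has
a representative `t ≥ 0` with `∑ t_j ≤ D − 1`; then the coefficients on the chosen columns are
bounded by `R/D + D − 1 ≤ R`. [cite: EvertseGyory2015, Lemma 4.3.5 (p. 72)] -/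
theorem bfrt_exists_small_solution {m : ℕ} {κ : Type*} [Fintype κ] (f : κ → Fin m → ℤ)
    (hgen : Submodule.span ℤ (Set.range f) = ⊤) (f₀ : Fin m → ℤ) (R : ℝ)
    (hR : ∀ e : Fin m → Option κ, Function.Injective e →
      |(((Matrix.of fun i k => (e k).elim f₀ f i).det : ℤ) : ℝ)| ≤ R) :
    ∃ b : κ → ℤ, f₀ = ∑ j, b j • f j ∧ ∀ j, (|b j| : ℝ) ≤ R := by
  classical
  -- Step 0: the degenerate case `m = 0`
  rcases Nat.eq_zero_or_pos m with hm | hm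
  · subst hm
    have h1 : (1 : ℝ) ≤ R := by
      have := hR (fun k => Fin.elim0 k) (fun k => Fin.elim0 k)
      rwa [Matrix.det_isEmpty, Int.cast_one, abs_one] at this
    refine ⟨0, ?_, fun j => ?_⟩
    · ext i; exact Fin.elim0 i
    · simp only [Pi.zero_apply, abs_zero, Int.cast_zero]
      linarith
  -- Step 1: a maximal minor `A`, `D = |det A| ≥ 1`
  obtain ⟨e₁, -, hdet₁⟩ := exists_minor_ne_zero f hgen
  haveI : Nonempty (Fin m → κ) := ⟨e₁⟩
  obtain ⟨eS, hmax⟩ :=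
    Finite.exists_max (fun e : Fin m → κ => |(Matrix.of fun i k => f (e k) i).det|)
  set A : Matrix (Fin m) (Fin m) ℤ := Matrix.of fun i k => f (eS k) i with hA
  have hmax' : ∀ e : Fin m → κ, |(Matrix.of fun i k => f (e k) i).det| ≤ |A.det| := hmax
  have hDpos : 0 < |A.det| := (abs_pos.mpr hdet₁).trans_le (hmax' e₁)
  have hAdet : A.det ≠ 0 := abs_pos.mp hDpos
  set D : ℕ := A.det.natAbs with hD
  have hDcast : (D : ℤ) = |A.det| := Int.natCast_natAbs _
  have hD1 : 1 ≤ D := by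
    have : (1 : ℤ) ≤ D := by rw [hDcast]; exact hDpos
    exact_mod_cast this
  have heS : Function.Injective eS := by
    intro k k' hkk'
    by_contra hne
    exact hAdet (Matrix.det_zero_of_column_eq hne (fun i => by simp [hA, hkk']))
  have hDR : (D : ℝ) ≤ R := by
    have := hR (fun k => some (eS k)) ((Option.some_injective _).comp heS)
    have hcast : ((D : ℤ) : ℝ) = |((A.det : ℤ) : ℝ)| := by rw [hDcast, Int.cast_abs]
    have hD' : (D : ℝ) = |((A.det : ℤ) : ℝ)| := by exact_mod_cast hcast
    rw [hD']
    simpa [hA] using this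
  have hDRZ : (1 : ℝ) ≤ R := le_trans (by exact_mod_cast hD1) hDR
  -- Step 2: Cramer vectors and their bounds
  set u : Fin m → ℤ := A.cramer f₀ with hu
  set v : κ → Fin m → ℤ := fun j => A.cramer (f j) with hv
  have hu_bound : ∀ k, (|u k| : ℝ) ≤ R := by
    intro k
    let e : Fin m → Option κ := fun k' => if k' = k then none else some (eS k')
    have he : Function.Injective e := by
      intro a b hab
      simp only [e] at hab
      by_cases ha : a = k <;> by_cases hb : b = k
      · rw [ha, hb]
      · rw [if_pos ha, if_neg hb] at hab; exact absurd hab.symm (Option.some_ne_none _)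
      · rw [if_neg ha, if_pos hb] at hab; exact absurd hab (Option.some_ne_none _)
      · rw [if_neg ha, if_neg hb] at hab; exact heS (Option.some_injective _ hab)
    have hmat : A.updateCol k f₀ = Matrix.of fun i k' => (e k').elim f₀ f i := by
      ext i k'
      simp only [Matrix.updateCol_apply, hA, Matrix.of_apply, e]
      split_ifs <;> rfl
    have := hR e he
    rw [← hmat] at this
    rw [hu, Matrix.cramer_apply]
    exact_mod_cast this
  have hv_bound : ∀ j k, |v j k| ≤ |A.det| := by
    intro j k
    have hmat : A.updateCol k (f j) = Matrix.of fun i k' => f (Function.update eS k j k') i := by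
      ext i k'
      simp only [Matrix.updateCol_apply, hA, Matrix.of_apply, Function.update_apply]
      split_ifs <;> rfl
    show |A.cramer (f j) k| ≤ |A.det|
    rw [Matrix.cramer_apply, hmat]
    exact hmax' _
  -- Step 3: the group `G = (ℤ/D)^m` and the map `cr = (cramer A ·) mod D`
  haveI : NeZero D := ⟨by omega⟩
  let castZ : (Fin m → ℤ) →ₗ[ℤ] (Fin m → ZMod D) :=
    ((Int.castAddHom (ZMod D)).compLeft (Fin m)).toIntLinearMap
  let cr : (Fin m → ℤ) →ₗ[ℤ] (Fin m → ZMod D) := castZ ∘ₗ A.cramer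
  have cr_apply : ∀ w k, cr w k = ((A.cramer w k : ℤ) : ZMod D) := fun w k => rfl
  have cr_eq_zero_iff : ∀ w, cr w = 0 ↔ ∀ k, A.det ∣ A.cramer w k := by
    intro w
    constructor
    · intro h k
      have hk := congrFun h k
      rw [cr_apply, Pi.zero_apply, ZMod.intCast_zmod_eq_zero_iff_dvd, hDcast, abs_dvd] at hk
      exact hk
    · intro h
      ext k
      rw [cr_apply, Pi.zero_apply, ZMod.intCast_zmod_eq_zero_iff_dvd, hDcast, abs_dvd]
      exact h k
  have hker : ∀ x, cr (A *ᵥ x) = 0 := by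
    intro x
    rw [cr_eq_zero_iff]
    intro k
    rw [Matrix.cramer_eq_adjugate_mulVec, Matrix.mulVec_mulVec, Matrix.adjugate_mul,
      Matrix.smul_mulVec, Matrix.one_mulVec]
    exact ⟨x k, rfl⟩
  -- Step 4: `#(range cr) ≤ D = [ℤ^m : A ℤ^m]`
  let LA : Submodule ℤ (Fin m → ℤ) := Submodule.span ℤ (Set.range (f ∘ eS))
  have hliQ : LinearIndependent ℚ (fun k => fun i => (f (eS k) i : ℚ)) := by
    have hunit : IsUnit ((Int.castRingHom ℚ).mapMatrix A) := by
      rw [Matrix.isUnit_iff_isUnit_det, ← RingHom.map_det, isUnit_iff_ne_zero]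
      exact (map_ne_zero_iff _ (RingHom.injective_int _)).mpr hAdet
    have := Matrix.linearIndependent_cols_iff_isUnit.mpr hunit
    have hcolA : ((Int.castRingHom ℚ).mapMatrix A).col = fun k i => (f (eS k) i : ℚ) := by
      ext k i
      simp [hA, Matrix.col]
    rw [hcolA] at this
    exact this
  have hliZ : LinearIndependent ℤ (f ∘ eS) := by
    let castL : (Fin m → ℤ) →ₗ[ℤ] (Fin m → ℚ) := ((Int.castAddHom ℚ).compLeft (Fin m)).toIntLinearMap
    have h1 : LinearIndependent ℤ (fun k => fun i => (f (eS k) i : ℚ)) := by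
      refine hliQ.restrict_scalars ?_
      intro a b hab
      simpa using hab
    exact LinearIndependent.of_comp castL h1
  let bN : Basis (Fin m) ℤ LA := Basis.span hliZ
  have hindex : Nat.card ((Fin m → ℤ) ⧸ LA) = D := by
    have h := Submodule.natAbs_det_basis_change (Pi.basisFun ℤ (Fin m)) LA bN
    rw [← h]
    have hcoe : ((↑) : LA → Fin m → ℤ) ∘ bN = f ∘ eS := by
      funext k
      exact congrArg Subtype.val (Basis.span_apply hliZ k)
    rw [hcoe, Pi.basisFun_det_apply]
    have : Matrix.of (f ∘ eS) = A.transpose := by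
      ext k i
      simp [hA]
    rw [this, Matrix.det_transpose]
  have hLAker : LA ≤ LinearMap.ker cr := by
    have hLA : LA = LinearMap.range A.mulVecLin := by
      rw [Matrix.range_mulVecLin]
      rfl
    intro x hx
    rw [hLA] at hx
    obtain ⟨y, rfl⟩ := hx
    exact hker y
  haveI : Finite ((Fin m → ℤ) ⧸ LA) := Nat.finite_of_card_ne_zero (by rw [hindex]; omega)
  have hcard_range : Nat.card (LinearMap.range cr) ≤ D := by
    have hrange : LinearMap.range (LA.liftQ cr hLAker) = LinearMap.range cr :=
      Submodule.range_liftQ LA cr hLAker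
    calc Nat.card (LinearMap.range cr) = Nat.card (LinearMap.range (LA.liftQ cr hLAker)) := by
          rw [hrange]
      _ ≤ Nat.card ((Fin m → ℤ) ⧸ LA) :=
          Nat.card_le_card_of_surjective _ (LinearMap.surjective_rangeRestrict _)
      _ = D := hindex
  -- Step 5: the word-length bound in the finite set `T = range cr`
  let T : Finset (Fin m → ZMod D) := Finset.univ.filter (fun x => x ∈ LinearMap.range cr)
  have hTcard : T.card ≤ D := by
    have : T.card = Nat.card (LinearMap.range cr) := by
      rw [Nat.card_eq_fintype_card, Fintype.card_subtype]
    rw [this]; exact hcard_range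
  let ν := {j : κ // j ∉ Set.range eS}
  let g : ν → (Fin m → ZMod D) := fun j => cr (f j)
  have hT : ∀ t : ν → ℕ, ∑ j, t j • g j ∈ T := by
    intro t
    simp only [T, Finset.mem_filter, Finset.mem_univ, true_and]
    have : ∑ j, t j • g j = cr (∑ j : ν, (t j : ℤ) • f j) := by
      rw [map_sum]
      refine Finset.sum_congr rfl fun j _ => ?_
      rw [map_zsmul, natCast_zsmul]
    rw [this]
    exact LinearMap.mem_range_self _ _
  -- an integer solution, reduced mod `D` on the free columns
  obtain ⟨b₀, hb₀⟩ := (Submodule.mem_span_range_iff_exists_fun ℤ).mp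
    (show f₀ ∈ Submodule.span ℤ (Set.range f) by rw [hgen]; exact Submodule.mem_top)
  let t₀ : ν → ℕ := fun j => (b₀ j % D).toNat
  have hDsmul : ∀ x : Fin m → ZMod D, (D : ℤ) • x = 0 := by
    intro x
    ext k
    simp [zsmul_eq_mul]
  have ht₀ : ∀ j : ν, b₀ j • g j = t₀ j • g j := by
    intro j
    have hdecomp : b₀ j = (t₀ j : ℤ) + D * (b₀ j / D) := by
      have h1 := Int.emod_add_mul_ediv (b₀ j) D
      have h2 : ((t₀ j : ℕ) : ℤ) = b₀ j % D :=
        Int.toNat_of_nonneg (Int.emod_nonneg _ (by exact_mod_cast (show D ≠ 0 by omega)))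
      rw [h2, h1]
    rw [hdecomp, add_zsmul, mul_comm, mul_zsmul, hDsmul, smul_zero, add_zero, natCast_zsmul]
  have hcols : ∀ k, cr (f (eS k)) = 0 := by
    intro k
    have : f (eS k) = A *ᵥ Pi.single k 1 := by
      rw [Matrix.mulVec_single_one]
      ext i
      simp [hA, Matrix.col]
    rw [this]
    exact hker _
  -- splitting sums over `κ` into the chosen columns and the free columns
  have hsplit : ∀ {β : Type} [AddCommMonoid β] (φ : κ → β),
      ∑ j, φ j = ∑ k, φ (eS k) + ∑ j : ν, φ j := by
    intro β _ φ
    rw [← Finset.sum_filter_add_sum_filter_not Finset.univ (fun j => j ∈ Set.range eS)]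
    congr 1
    · have himg : Finset.univ.filter (fun j => j ∈ Set.range eS) = Finset.univ.image eS := by
        ext j
        simp
      rw [himg, Finset.sum_image fun a _ b _ h => heS h]
    · exact Finset.sum_subtype _ (fun j => by simp) φ
  have hcr0 : cr f₀ = ∑ j : ν, t₀ j • g j := by
    rw [← hb₀, map_sum, hsplit (fun j => cr (b₀ j • f j))]
    have hzero : ∑ k, cr (b₀ (eS k) • f (eS k)) = 0 :=
      Finset.sum_eq_zero fun k _ => by rw [map_zsmul, hcols, zsmul_zero]
    rw [hzero, zero_add]
    refine Finset.sum_congr rfl fun j _ => ?_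
    rw [map_zsmul]
    exact ht₀ j
  obtain ⟨t, ht, htle⟩ := exists_sum_nsmul_eq_of_sum_le g T hT t₀
  have htD : ∑ j, t j + 1 ≤ D := htle.trans hTcard
  -- Step 6: the coefficients on the chosen columns
  set w : Fin m → ℤ := f₀ - ∑ j : ν, (t j : ℤ) • f (j : κ) with hw
  have hcrw : cr w = 0 := by
    rw [hw, map_sub, hcr0, ← ht, map_sum, sub_eq_zero]
    refine Finset.sum_congr rfl fun j _ => ?_
    rw [map_zsmul, natCast_zsmul]
  have hdvd : ∀ k, A.det ∣ A.cramer w k := (cr_eq_zero_iff w).mp hcrw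
  choose c hc using hdvd
  -- `hc k : A.cramer w k = A.det * c k`
  have hAc : A *ᵥ c = w := by
    have h1 : A.det • (A *ᵥ c) = A.det • w := by
      calc A.det • (A *ᵥ c) = A *ᵥ (A.det • c) := (Matrix.mulVec_smul A A.det c).symm
        _ = A *ᵥ (A.cramer w) := by
            congr 1
            ext k
            rw [Pi.smul_apply, smul_eq_mul, ← hc k]
        _ = A.det • w := Matrix.mulVec_cramer A w
    exact smul_right_injective (Fin m → ℤ) hAdet h1
  have hAc' : ∑ k, c k • f (eS k) = w := by
    rw [← hAc]
    ext i
    simp [hA, Matrix.mulVec, dotProduct, Finset.sum_apply, mul_comm]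
  -- Step 7: the solution
  let b : κ → ℤ := fun j =>
    if h : j ∈ Set.range eS then c ((Equiv.ofInjective eS heS).symm ⟨j, h⟩) else
      if h' : j ∉ Set.range eS then (t ⟨j, h'⟩ : ℤ) else 0
  have hbS : ∀ k, b (eS k) = c k := by
    intro k
    simp only [b, Set.mem_range_self, dif_pos]
    congr 1
    exact Equiv.ofInjective_symm_apply heS k
  have hbN : ∀ j : ν, b j = t j := by
    intro j
    have hj : (j : κ) ∉ Set.range eS := j.2
    simp only [b, hj, dif_neg, not_false_eq_true, dif_pos, Subtype.coe_eta]
  refine ⟨b, ?_, ?_⟩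
  · -- `f₀ = ∑ b j • f j`
    rw [hsplit (fun j => b j • f j)]
    simp_rw [hbS, hbN, hAc', hw]
    abel
  · -- the bounds
    intro j
    by_cases hj : j ∈ Set.range eS
    · obtain ⟨k, rfl⟩ := hj
      rw [hbS]
      -- `|det A| * |c k| = |cramer A w k| ≤ |u k| + ∑ t_j |v j k| ≤ R + (D - 1) D ≤ R D`
      have hcr : A.cramer w k = u k - ∑ j : ν, (t j : ℤ) * v j k := by
        rw [hw, map_sub, map_sum, hu, hv]
        simp only [Pi.sub_apply, Finset.sum_apply, map_zsmul, Pi.smul_apply, smul_eq_mul]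
      have hbound : ((|A.det| : ℤ) : ℝ) * |(c k : ℝ)| ≤
          R + (∑ j, t j : ℕ) * ((|A.det| : ℤ) : ℝ) := by
        have h1 : ((|A.det| : ℤ) : ℝ) * |(c k : ℝ)| = |((A.cramer w k : ℤ) : ℝ)| := by
          rw [hc k, Int.cast_mul, abs_mul, Int.cast_abs]
        rw [h1, hcr, Int.cast_sub, Int.cast_sum]
        simp only [Int.cast_mul, Int.cast_natCast]
        refine (abs_sub _ _).trans ?_
        refine add_le_add (hu_bound k) ?_
        refine (Finset.abs_sum_le_sum_abs _ _).trans ?_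
        rw [Nat.cast_sum, Finset.sum_mul]
        refine Finset.sum_le_sum fun j _ => ?_
        rw [abs_mul, Nat.abs_cast]
        refine mul_le_mul_of_nonneg_left ?_ (Nat.cast_nonneg _)
        have := hv_bound j k
        have hcast : ((|v j k| : ℤ) : ℝ) ≤ ((|A.det| : ℤ) : ℝ) := by exact_mod_cast this
        rwa [Int.cast_abs] at hcast
      have hDreal : (D : ℝ) = ((|A.det| : ℤ) : ℝ) := by
        have : ((D : ℤ) : ℝ) = ((|A.det| : ℤ) : ℝ) := by rw [hDcast]
        exact_mod_cast this
      have hDpos' : (0 : ℝ) < D := by exact_mod_cast (show 0 < D by omega)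
      have hsum : ((∑ j, t j : ℕ) : ℝ) ≤ D - 1 := by
        have : ((∑ j, t j : ℕ) : ℝ) + 1 ≤ D := by exact_mod_cast htD
        linarith
      rw [← hDreal] at hbound
      -- `D * |c k| ≤ R + (D - 1) * D ≤ R * D`
      have h2 : (D : ℝ) * |(c k : ℝ)| ≤ R * D := by
        calc (D : ℝ) * |(c k : ℝ)| ≤ R + (∑ j, t j : ℕ) * D := hbound
          _ ≤ R + (D - 1) * D := by nlinarith
          _ ≤ R * D := by nlinarith
      have := le_of_mul_le_mul_left (by linarith [h2] : (D : ℝ) * |(c k : ℝ)| ≤ D * R) hDpos'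
      exact_mod_cast this
    · have hj' : b j = t ⟨j, hj⟩ := hbN ⟨j, hj⟩
      rw [hj']
      have h1 : ((t ⟨j, hj⟩ : ℕ) : ℝ) + 1 ≤ D := by
        have : t ⟨j, hj⟩ + 1 ≤ D :=
          le_trans (Nat.add_le_add_right (Finset.single_le_sum (fun i _ => Nat.zero_le (t i))
            (Finset.mem_univ _)) 1) htD
        exact_mod_cast this
      rw [Int.cast_natCast, Nat.abs_cast]
      linarith

end BFRT

end Literature.NumberTheory.DiophantineGeometry.Dioph

end
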